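import Mathlib
import HarnessLib
import HarnessLib.Audit
import Summits.KontsevichZagierPeriods.Statement
import Literature.NumberTheory.Transcendental.MZVSimplexRep
import HarnessLib.Audit.Status.Attr

/-!
Route: ScissorsAvatars

DORMANT since 2026-08-23T18:11:45Z (reconciler: no traction for 6.1 d (last activity item-evidence-added at 2026-08-17T14:10:54Z); parked, not closed — `ledger route dormant route-KontsevichZagierPeriods-ScissorsAvatars --off` to reacti) — unstaffed, not closed; items shared with open routes are served there. `ledger route dormant <id> --off` reactivates.

Route ScissorsAvatars (card scissors-avatars-bloch-aomoto-cells, parts (a)+(c); part (b) hyperbolic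
= route HyperbolicBloch).
THESIS X (it suffices to show X). Call SCISSORS the Newton–Leibniz-free sub-calculus of the fixed KZ
calculus — rules 1a, 1b, 2 only:
C12 := AddSubgroup.closure (KZ.domainAddRel ∪ KZ.integrandAddRel ∪ KZ.changeOfVariablesRel) ⊆
KZ.relations; it preserves dimension.
The card's observation: the classical scissors presentations of mixed-Tate periods (Aomoto/BGSV
pairs of simplices; Brown–Carr–Schneps
cells of M_{0,n}(R)) use only these rules (cuts; projective/dihedral maps have RATIONAL Jacobians),
so on that fragment Conjecture 1
should hold INSIDE C12, in the dimension (= weight) where the representations live — no Stokes, no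
regularisation, no padding.
X := (S) MzvScissorsSector — for every weight w, every Z-combination c of Kontsevich simplex reps
mzvRep s (weight s = w) with eval c = 0
lies in C12 — AND (O) OffSectorReduction — every vanishing formal combination is KZ-equivalent to a
vanishing homogeneous MZV combination
(= Conjecture 1 off the sector + weight separation: the honest complement, owned by routes
Grothendieck/CoactionDevissage/LowDimension).
Lean (folder Sketch.lean rc 0): MzvScissorsSector := ∀ (w : ℕ) (c : KZ.FormalRep), c ∈
AddSubgroup.closure {x | ∃ s (hs : MZV.IsAdmissible s),
 MZV.weight s = w ∧ x = KZ.of (KZ.mzvRep s hs (KZ.mzvIntegrand_isSemialgebraicFunOn_holds s)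
(KZ.mzvIntegrand_integrableOn_holds s hs))} →
 KZ.eval c = 0 → c ∈ C12;  OffSectorReduction := ∀ c, KZ.eval c = 0 → ∃ w c', c' ∈ (same span) ∧
KZ.eval c' = 0 ∧ c - c' ∈ KZ.relations.
Assembly (PROVED privately in Sketch.lean, 12 lines: closure_mono + add_mem): FiveTermScissors →
DestabilisedScissors → Zeta31Scissors →
MzvScissorsSector → OffSectorReduction → KontsevichZagierPeriods.
The ranked cruxes are the first rungs and the structural core of (S): (2) FiveTermScissors — the
Abel–Spence five-term relation of the
REAL dilogarithm at rational arguments as an identity among six 2-dimensional rational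
representations by cuts and projectivities only
(Aomoto avatar, weight 2); (3) DestabilisedScissors — 'Newton–Leibniz only changes dimension': a KZ
relation among representations of
ONE dimension n already lies in C12 (the destabilised complement of route ScissorsTransport's
stabilised transport; structural, possibly
provable by lifting derivations to regions-under-graphs); (4) Zeta31Scissors — ζ(4) = 4ζ(3,1) inside
C12 (cell avatar, weight 4; the
C12-sharpening of Grothendieck 0275 / CoactionDevissage Stuffle); (5) MzvScissorsSector itself (⇐
(3) ∧ the NL-allowed MZV sector, glue filed).

Rationale: WHY THIS LINE. The scissors presentations of mixed-Tate periods — BMS/BGSV pairs of simplices =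
Aomoto polylogarithms [BeilinsonMacphersonSchechtman1987, BeilinsonEtAl2007, Aomoto1982] and
Brown–Carr–Schneps cells of M_{0,n}(R) [BrownCarrSchneps2010] — use only KZ rules 1) and 2): cuts,
and projective/dihedral maps with RATIONAL Jacobians; BCS's three relation families are literally
domain additivity of a product domain into cells (Prop 2.19), rule 2 for PGL_2 relabellings, and
integrand additivity among convergent insertion forms. So on this fragment Conjecture 1 should live
in the NL-free sub-calculus C12 := closure(1a ∪ 1b ∪ 2), in fixed dimension = weight, where the
AlgebraicPrimitives barrier is absent and nothing is regularised. The structural form is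
DestabilisedScissors ('rule 3 only changes dimension'), the destabilised complement of route
ScissorsTransport (which pads by [0,1]^M and transports by ONE map; its DimOneTransportFails
concerns one map — chains in dimension 1 are fine, checked by hand here for KZ's own π-pair: x =
2t/(1+t²) makes both reps rational, their difference is G′ with G = 2t(1−t²)/(1+t²)², and the
monotonicity cells at t = ±(√2−1) give the cut-and-substitute chain). Imported areas: scissors
congruence / Aomoto configurations (weight-2 crux), genus-0 moduli combinatorics (BCS; weight-4
crux, sector node), the tree's MZV arithmetic (mzvRep_value_holds, mzvSpace_four_eq,
MultipleZetaDuality). Neighbours: CoactionDevissage treats the MZV sector with NL allowed (Stuffle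
3173 via Soudères, Duality 3171, TorsionFree 3169 via slabs) — our items are the C12/fixed-dimension
sharpenings and share no signature; HyperbolicBloch owns the Bloch–Wigner five-term in H³ (3469) —
ours is the REAL twin in the plane; Grothendieck 0275 is Zeta31Scissors with NL allowed.
RANKED CRUXES. #2 FiveTermScissors — [Dx]+[Dy]−[Dxy]−[Du]−[Dv]−[P] ∈ C12 with Dz = [1>t0>t1>0,
z/(t0(1−z t1))] (= Li2 z), P = [(1−u,1)×(1−v,1), 1/(t0 t1)] (= log(1−u)log(1−v)), u(1−xy)=x(1−y),
v(1−xy)=y(1−x), 0<x,y<1 rational; the identity is Abel/Hill's (Zagier2007Dilogarithm Ch.I §2),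
checked numerically here (residual ≤ 3e-16 at 4 points). Why it might fail: printed proofs
differentiate ('All of the functional equations of Li2 are easily proved by differentiation', loc.
cit.; Rogers L from L′(x), Ch.II §1.A) or dissect IDEAL HYPERBOLIC tetrahedra (DupontSah1982);
Aomoto's additivity (H2.1)–(H2.3) (Aomoto1982 §3) runs through simplices crossed by polar lines =
divergent real integrals; his (0.2)–(0.3) points at path concatenation = cutting {0<s<t} into two
simplices and a rectangle, but the Möbius reparametrisations move tangential base points. #3
DestabilisedScissors — ∀ n, c ∈ closure(range of n-dim generators) → c ∈ KZ.relations → c ∈ C12. Why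
it might fail: same-dimension identities known only through Stokes with boundary terms
(Legendre/Riemann bilinear in dimension 2, route UnfoldedStokes) would need planar scissors proofs;
lifting a derivation through lower dimensions to regions-under-graphs needs a common fibre
coordinate, which changes of variables destroy. #4 Zeta31Scissors — Grothendieck's 0275 pair (ζ(4)
vs 4ζ(3,1), 4-dim simplex reps) with conclusion in C12. Why it might fail: BCS §1.2 cannot deduce
stuffle from their three families in general; in weight 4 only a computer rank count (d_4 = 1, n ≤
9) says a derivation exists; Soudères' cubical recipe (CoactionDevissage 3173) needs every summand
of the pointwise partial-fraction identity separately integrable and the inverse blow-up injective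
on cells. #5 MzvScissorsSector — the sector node, conjecture-strength (⇐ DestabilisedScissors ∧ the
NL-allowed MZV sector of CoactionDevissage, glue MzvSectorGlue filed and proved privately). Why it
might fail: an MZV relation needing a dimension detour; BCS generation failing beyond weight 6 (Conj
1.3 verified for n ≤ 9 only).
KILL CRITERIA. An additive invariant of C12 in dimension 2 or 4 that vanishes on C12 but not on the
five-term or the ζ(3,1) combination refutes DestabilisedScissors and the thesis: close as refuted
with census 'rule 3 is indispensable in fixed dimension at …' (feeds Neg pressure point (a)).
Refutation of MzvScissorsSector alone re-scopes the route to low weight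
(MzvScissorsSectorWeightLeFour). OffSectorReduction is the summit off-sector: not a kill switch, not
staffed.
NOT DECOMPOSED YET. CellTransfer (every BCS modular-shuffle / dihedral / polygon relation ∈ C12;
needs `KZ.cellRep` = cells of M_{0,n}(R) with cell-form integrands — definition request filed);
StuffleScissors(s,s′) in C12 for all admissible pairs; the Aomoto/BGSV transfer in weight n (pairs
of simplices, additivity in L and M, PGL_{n+1}(Q)); the conditional reduction of the dilogarithm
sector to Bloch-group regulator injectivity (no Bloch-group vocabulary in Lean; HyperbolicBloch owns
the volume form); cyclotomic cells. Splits foreseen: MzvScissorsSector ⇐ DestabilisedScissors +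
NL-sector (glue filed); MzvScissorsSectorWeightLeFour ⇐ Zeta31Scissors + Zeta22Scissors + duality
move + DivisibilityScissors.
CHEAPEST FALSIFIER. Run the tree's move bookkeeping on KZ2001 pp.9–10: EulerScissors (6ζ(2)-rep ~
[R², 1/((1+x²)(1+y²))]) must close with rules 1a/1b/2 only — if even Calabi's chain needs a
Newton–Leibniz step inside dimension 2, DestabilisedScissors is dead on arrival; second cheapest:
search weight-4 cell relations (BCS §4 tables for M_{0,7}) for an explicit derivation of ζ(3,1) =
ζ(4)/4 and check each step's integrability.
TWO-LAYER PLAN. Layer 1 = the four cruxes; layer 2 only after a close: Zeta31Scissors closing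
triggers the split of MzvScissorsSectorWeightLeFour (children Zeta22Scissors, duality-in-C12, glue
via DivisibilityScissors and mzvSpace_four_eq); FiveTermScissors closing triggers the Aomoto
transfer in weight 2 (additivity in L/M, projective invariance) as ≤ 3 children.
SUPPORT. Zeta22Scissors (4ζ(2,2) = 3ζ(4) in C12); EulerScissors (KZ2001's Calabi chain is NL-free:
one algebraic CoV + the involution (ξ,η) ↦ (1/ξ,1/η); cousin of CompiledSubstitutions ZetaEvenBKC
k=1 and CoactionDevissage EulerBasel, both NL-allowed); DivisibilityScissors (N•c ∈ C12 → c ∈ C12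
via [σ,f] ~ N[σ,f/N] — no slabs exist in fixed dimension; cf. card
integral-domain-roots-of-identities L0); MzvScissorsSectorWeightLeFour; MzvSectorGlue;
OffSectorReduction (complement). (The shared kernel-form step stmt-0197, KZKernelConjecture →
summit, was detached from this route at rev 2: the deciding theorem `closes` goes through
MzvScissorsSector + OffSectorReduction, and the item only dragged the open KZKernelConjecture into
the dependency cone; it stays with routes NoriTransfer / Grothendieck / ExpConservative.)
DEFINITION REQUESTS. KZ.cellRep (Literature/NumberTheory/Transcendental): for a cyclic order γ on
{0,1,∞,t_1..t_ℓ} the open cell X_γ ⊆ R^ℓ of M_{0,ℓ+3}(R) and, for a second cyclic order η, the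
cell-form integrand ω_η = ±1/Π(successive differences) (BrownCarrSchneps2010 §2.2–2.3), as a
KZ.IntegralRep ℓ when ω_η converges on the closed cell.

Novelty: NOVELTY (D-0021; search-before-claim, 2026-08-15 11:00–11:30Z). Queries: crossref 'five-term
relation dilogarithm scissors congruence'
(15 rows: Dupont–Sah/Nankai tracts, Zakharevich doi:10.4310/hha.2012.v14.n1.a9, Greenberg 1983 'A
smooth scissors congruence problem'
doi:10.2307/2044921 — paywalled, acq-02247 —, Lichtenbaum 1989, Mohanty 2003 Regge symmetry);
crossref 'Aomoto dilogarithms pairs of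
triangles Abel equation' (found Aomoto1982 doi:10.1017/s0027763000020092 READ pp.55–56, 68–70:
Abel's equation for hyperlogarithms =
additivity (H2.3) over the n+2 simplices of n+2 hyperplanes + projective invariance (H2.1),
functions locally analytic — NOT absolutely
convergent real integrals; (0.2)–(0.3): five-term 'comes from the co-algebra property of iterated
integrals along two paths');
BeilinsonEtAl2007 (BGSV) and BeilinsonMacphersonSchechtman1987 (cited via the card);
BrownCarrSchneps2010 = arXiv:0910.0122 READ §1–§2.3
(three families; Prop 2.19 modular shuffle = cellular decomposition of f^{-1}(X1×X2); Conj 1.3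
verified n ≤ 9; §1.2 'we are unable to
deduce the regularised stuffle relations'); KontsevichZagier2001 pp.9–10 READ (Calabi chain: one
algebraic CoV + the involution
(ξ,η)↦(1/ξ,1/η) — NL-free, unremarked); Zagier2007Dilogarithm READ (author copy) Ch.I §2 'All of the
functional equations of Li2 are
easily proved by differentiation', Ch.II §1.A (Rogers L′), Ch.II §2 (triangulated 3-cycles give D-
and Rogers-identities 'by virtue of
the functional equation'); lit fron  [refs: 10.4310/hha.2012.v14.n1.a9, 10.2307/2044921, 10.1017/s0027763000020092, 0910.0122, doi:10.4310/hha.2012.v14.n1.a9, doi:10.2307/2044921, doi:10.1017/s0027763000020092, Aomoto1982, BeilinsonEtAl2007, BeilinsonMacphersonSchechtman1987, BrownCarrSchneps2010, KontsevichZagier2001]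

Barriers (technique_class: scissors-presentation nl-free-subcalculus destabilisation): - technique_class: scissors-presentation nl-free-subcalculus destabilisation
- Literature.Barriers.KontsevichZagierPeriods.noSemialgebraicPrimitive_inv_sub_two: EVADED outright
— no instance of rule 3 occurs in C12; the barrier kills fibrewise
Newton–Leibniz/primitive-elimination strategies only, and DestabilisedScissors is precisely the
statement that such steps are never needed within a fixed dimension.
- Literature.Barriers.KontsevichZagierPeriods.kzConjecture_implies_oddZetaAlgIndep: APPLIES only to
MzvScissorsSector jointly with OffSectorReduction (together they give the summit, hence GPC-strength
consequences); both are posed as open nodes (crux rank 5 / unstaffed complement), never claimed;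
FiveTermScissors, Zeta31Scissors assert no numerical transcendence (each is implied by the summit ∧
DestabilisedScissors) and DestabilisedScissors is structural.
- Literature.Barriers.KontsevichZagierPeriods.kzConjecture_implies_twoPiI_log_algIndep: same
confinement; the weight ≤ 4 statement MzvScissorsSectorWeightLeFour uses only the PROVED weight-4
values (mzvSpace_four_eq) and π ≠ 0.
- Literature.Barriers.KontsevichZagierPeriods.kzConjecture_implies_ellipticPeriods_algIndep: not
engaged on the mixed-Tate fragment; DestabilisedScissors touches elliptic sectors only structurally
(IF a Legendre-type pair is a KZ relation in dimension 2 THEN a planar scissors chain exists) — no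
transcendence claim.
- Literature.Barriers.KontsevichZagierPeriods.cressonViuSos_prop_3_2: EVADED — dissect

Novelty grade: new-combination — route-review + novelty (refuter 2026-08-15). new-combination = (i) scissors/cell presentations of mixed-Tate periods (Aomoto/BGSV simplices; Brown–Carr–Schneps cells, whose three relation families are cuts, PGL2 relabellings with rational Jacobian, integrand additivity) × (ii) the Newton–Leibniz-fre (refuter refuter-rreview-route-SmoothPoincare4-Cs-4e9ba0e6-0, 2026-08-15T13:58:59Z; prior: BrownCarrSchneps2010 arXiv:0910.0122 (cells of M_{0,n}(R), three relation families, Conj 1.3 n<=9), Aomoto1982 doi:10.1017/s0027763000020092 (additivity (H2.1)-(H2.3); five-term from coalgebra of iterated integrals), BeilinsonEtAl2007 / BeilinsonMacphersonSchechtman1987 (BGSV/BMS scissors presentations), KontsevichZagier2001 §1.2 (rules 1-3; Calabi chain pp.9-10), Ayoub2015 Rem 1.2/1.5 (fixed numb)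

History (route lifecycle, newest last):
- 2026-08-15T16:13:57Z · rev 2: dropped KernelImpliesStatement — route-repair (cone): detach shared support item KernelImpliesStatement (stmt-0197, KZKernelConjecture → summit) from THIS route — it is not on the deciding path (planner-rbadge-KontsevichZagierPeriods-Scissor-b4f38ceb-g2-0)
- 2026-08-16T16:40:57Z · AUTO-CRUX (backfill): OffSectorReduction — hypotheses of the deciding theorem that nothing in the route derives are cruxes (operator:999:1813213)
- 2026-08-23T18:11:45Z · DORMANT — reconciler: no traction for 6.1 d (last activity item-evidence-added at 2026-08-17T14:10:54Z); parked, not closed — `ledger route dormant route-KontsevichZagier (operator:999:2530744)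

sub-problem: KontsevichZagierPeriods · status: dormant · opened planner-plancard-KontsevichZagierPeriods-Kont-e07cd5e4-0 2026-08-15T11:30:57Z · rev 2 · ledger route-KontsevichZagierPeriods-ScissorsAvatars
GENERATED by the gate from the ledger (D-0016/17). Provers cite these decls: `theorem foo : Summit.KontsevichZagierPeriods.KontsevichZagierPeriods.Theses.ScissorsAvatars.<Decl> := …` in Summits/KontsevichZagierPeriods/KontsevichZagierPeriods/Theorems/<Name>.lean.
-/

namespace Summit.KontsevichZagierPeriods.KontsevichZagierPeriods.Theses.ScissorsAvatars

open scoped BigOperators Topology Manifold Classical MeasureTheory ProbabilityTheory Matrix InnerProductSpace ComplexConjugate ContinuousMap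
open Filter Set Function TopologicalSpace MeasureTheory

attribute [summit_statement] _root_.KontsevichZagierPeriods

open Literature Periods

/-- item stmt-KontsevichZagierPeriods-4256 · crux · rank 2 · open · by planner
why it might fail: Printed proofs differentiate in x (Zagier2007 Ch.I §2, Ch.II §1.A) or dissect IDEAL hyperbolic tetrahedra (DupontSah1982); Aomoto's planar additivity runs through simplices crossed by polar lines = divergent reps; a convergent chain may not exist.
sources: Zagier2007Dilogarithm, Aomoto1982, BeilinsonEtAl2007, DupontSah1982, KontsevichZagier2001
[crux] The Abel–Spence–Hill five-term relation of the REAL dilogarithm at rational arguments is a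
SCISSORS identity in the plane: for rational 0<x,y<1 and u,v with u(1−xy)=x(1−y), v(1−xy)=y(1−x) (so
0<u,v<1), and any six 2-dim reps with the stated shapes — D_z = [{1>t0>t1>0}, z/(t0(1−z·t1))] (value
Li2(z); z = x, y, xy, u, v; integrand positive, absolutely integrable) and P = [(1−u,1)×(1−v,1),
1/(t0·t1)] (value log(1−u)·log(1−v) > 0) — the combination [Dx]+[Dy]−[Dxy]−[Du]−[Dv]−[P] lies in C12
:= AddSubgroup.closure (domainAddRel ∪ integrandAddRel ∪ changeOfVariablesRel) (the
Newton–Leibniz-free 'scissors' sub-calculus: rules 1a, 1b, 2). The underlying identity Li2(x)+Li2(y)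
= Li2(xy)+Li2(u)+Li2(v)+log(1−u)log(1−v) is Abel/Hill's form of the five-term relation
(Zagier2007Dilogarithm Ch.I §2; residual ≤ 3e-16 at 4 rational points, planner check). Derivation
templates: Aomoto1982 (0.2)–(0.3) — the five-term 'comes from the co-algebra property of iterated
integrals along two paths', i.e. CUT the ordered simplex {0<s<t<T} at an intermediate time into two
simplices and a rectangle (rule 1a) and reparametrise each piece by a Möbius/affine map with
rational Jacobian (rule 2); and §3 (H2.1) -/
@[route_item "route-KontsevichZagierPeriods-ScissorsAvatars"]
def FiveTermScissors : Prop :=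
  ∀ (x y u v : ℚ), 0 < x → x < 1 → 0 < y → y < 1 → u * (1 - x * y) = x * (1 - y) → v * (1 - x * y) = y * (1 - x) → ∀ (rx ry rxy ru rv p : Literature.NumberTheory.Transcendental.KZ.IntegralRep 2), rx.domain = Literature.NumberTheory.Transcendental.KZ.openOrderedSimplex 2 → Set.EqOn rx.integrand (fun t => (x : ℝ) / (t 0 * (1 - (x : ℝ) * t 1))) rx.domain → ry.domain = Literature.NumberTheory.Transcendental.KZ.openOrderedSimplex 2 → Set.EqOn ry.integrand (fun t => (y : ℝ) / (t 0 * (1 - (y : ℝ) * t 1))) ry.domain → rxy.domain = Literature.NumberTheory.Transcendental.KZ.openOrderedSimplex 2 → Set.EqOn rxy.integrand (fun t => ((x * y : ℚ) : ℝ) / (t 0 * (1 - ((x * y : ℚ) : ℝ) * t 1))) rxy.domain → ru.domain = Literature.NumberTheory.Transcendental.KZ.openOrderedSimplex 2 → Set.EqOn ru.integrand (fun t => (u : ℝ) / (t 0 * (1 - (u : ℝ) * t 1))) ru.domain → rv.domain = Literature.NumberTheory.Transcendental.KZ.openOrderedSimplex 2 → Set.EqOn rv.integrand (fun t => (v : ℝ)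 / (t 0 * (1 - (v : ℝ) * t 1))) rv.domain → p.domain = {t | ((1 - u : ℚ) : ℝ) < t 0 ∧ t 0 < 1 ∧ ((1 - v : ℚ) : ℝ) < t 1 ∧ t 1 < 1} → Set.EqOn p.integrand (fun t => 1 / (t 0 * t 1)) p.domain → Literature.NumberTheory.Transcendental.KZ.of rx + Literature.NumberTheory.Transcendental.KZ.of ry - Literature.NumberTheory.Transcendental.KZ.of rxy - Literature.NumberTheory.Transcendental.KZ.of ru - Literature.NumberTheory.Transcendental.KZ.of rv - Literature.NumberTheory.Transcendental.KZ.of p ∈ AddSubgroup.closure (Literature.NumberTheory.Transcendental.KZ.domainAddRel ∪ Literature.NumberTheory.Transcendental.KZ.integrandAddRel ∪ Literature.NumberTheory.Transcendental.KZ.changeOfVariablesRel)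

/-- item stmt-KontsevichZagierPeriods-4257 · crux · rank 3 · open · by planner
why it might fail: Same-dimension identities known only via Stokes with boundary terms (Legendre/Riemann-bilinear pairs in dim 2, route UnfoldedStokes) would need planar scissors chains; lifting derivations needs a common fibre coordinate that changes of variables destroy.
sources: KontsevichZagier2001, CressonViusos2022, BochnakCosteRoy1998, route-KontsevichZagierPeriods-ScissorsTransport
[crux] NEWTON–LEIBNIZ ONLY CHANGES DIMENSION (destabilisation). If a formal Z-combination c of
integral representations of ONE dimension n is a KZ relation (derivable with all four rules, through
any dimensions), then c already lies in C12 := AddSubgroup.closure (domainAddRel ∪ integrandAddRel ∪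
changeOfVariablesRel) (the Newton–Leibniz-free 'scissors' sub-calculus: rules 1a, 1b, 2), i.e. it is
derivable by cuts and Q-semialgebraic changes of variables without leaving dimension n. Structural
complement of route ScissorsTransport's NewtonLeibnizElimination (rule 3 ∈ ⟨1a,1b,2,slabs⟩,
stabilised by padding): here NO padding. Evidence/plan: (i) a rule-3 instance followed by its
inverse over the same base is a C12 chain — on cylindrical cells where f = ∂_t F has constant sign
the shear (x,t) ↦ (x,F(x,t)) is rule 2 with |det| = |f|, further shears u ↦ u − F(x,c_j(x)) and cuts
bring both bands to the common normal form [{x ∈ τ, 0<u<F(x,b x)−F(x,a x)}, 1]; (ii) base moves lift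
to regions-under-graphs: 1a trivially, 1b by the shear [0<u<g1+g2] = [0<u<g1] ∪ [g1<u<g1+g2], rule 2
by (x,u) ↦ (φ x, u/|J x|) (Jacobian 1); (iii) dimension 1 by hand: KZ's π-pair [(-1,1), 2√(1−x²)] ~
[(-1,1), 1/√(1− -/
@[route_item "route-KontsevichZagierPeriods-ScissorsAvatars"]
def DestabilisedScissors : Prop :=
  ∀ (n : ℕ) (c : Literature.NumberTheory.Transcendental.KZ.FormalRep), c ∈ AddSubgroup.closure (Set.range (fun r : Literature.NumberTheory.Transcendental.KZ.IntegralRep n => Literature.NumberTheory.Transcendental.KZ.of r)) → c ∈ Literature.NumberTheory.Transcendental.KZ.relations → c ∈ AddSubgroup.closure (Literature.NumberTheory.Transcendental.KZ.domainAddRel ∪ Literature.NumberTheory.Transcendental.KZ.integrandAddRel ∪ Literature.NumberTheory.Transcendental.KZ.changeOfVariablesRel)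

/-- item stmt-KontsevichZagierPeriods-4258 · crux · rank 4 · open · by planner
why it might fail: BCS §1.2 cannot deduce stuffle from their families in general; in weight 4 only a computer rank count asserts a derivation; Soudères' recipe needs each partial-fraction summand separately integrable and the blow-ups injective on the cells used.
sources: BrownCarrSchneps2010, Souderes2010, stmt-KontsevichZagierPeriods-0275, Zagier1994, KontsevichZagier2001
[crux] ζ(4) = 4ζ(3,1) INSIDE THE SCISSORS SUB-CALCULUS: for the two 4-dim rational simplex reps of
route Grothendieck's item 0275 (domain {1>t0>t1>t2>t3>0}, integrands 1/(t0 t1 t2 (1−t3)) [word 0001,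
ζ(4)] and 4/(t0 t1 (1−t2)(1−t3)) [4 × word 0011, 4ζ(3,1)]), of r − of r′ ∈ C12 :=
AddSubgroup.closure (domainAddRel ∪ integrandAddRel ∪ changeOfVariablesRel) (the Newton–Leibniz-free
'scissors' sub-calculus: rules 1a, 1b, 2) — same hypotheses as 0275
(stmt-KontsevichZagierPeriods-0275, conclusion there: ∈ KZ.relations), sharper conclusion; a proof
here closes 0275 by AddSubgroup.closure_mono, and conversely any proof of 0275 or of
CoactionDevissage.Stuffle (3173) that never invokes newtonLeibnizRel proves this item. Two NL-free
recipes in sight: (A) CELLS (BrownCarrSchneps2010): ζ(2)·ζ(2) as the product rep on Δ²×Δ² ⊂ R⁴, cut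
into the 6 order cells (rule 1a; = shuffle 2ζ(2,2)+4ζ(3,1)), then BCS's modular shuffles with OTHER
cyclic structures on M_{0,7}(R) (cells where some t_i ∉ (0,1): unbounded rational reps), PGL_2
relabellings to the standard cell (rule 2, rational Jacobian), re-expression in convergent insertion
forms (rule 1b) — BCS verified dim = d_4 = 1 in weight 4 by computer ( -/
@[route_item "route-KontsevichZagierPeriods-ScissorsAvatars"]
def Zeta31Scissors : Prop :=
  ∀ (r r' : Literature.NumberTheory.Transcendental.KZ.IntegralRep 4), r.domain = {t | 1 > t 0 ∧ t 0 > t 1 ∧ t 1 > t 2 ∧ t 2 > t 3 ∧ t 3 > 0} → Set.EqOn r.integrand (fun t => 1 / (t 0 * t 1 * t 2 * (1 - t 3))) r.domain → r'.domain = r.domain → Set.EqOn r'.integrand (fun t => 4 / (t 0 * t 1 * (1 - t 2) * (1 - t 3))) r'.domain → Literature.NumberTheory.Transcendental.KZ.of r - Literature.NumberTheory.Transcendental.KZ.of r' ∈ AddSubgroup.closure (Literature.NumberTheory.Transcendental.KZ.domainAddRel ∪ Literature.NumberTheory.Transcendental.KZ.integrandAddRel ∪ Literature.NumberTheory.Tr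anscendental.KZ.changeOfVariablesRel)

/-- item stmt-KontsevichZagierPeriods-4259 · crux · rank 5 · open · by planner
why it might fail: Some MZV relation may need a dimension-changing detour (regularised double shuffle is the only known engine beyond weight 6), or BCS generation (Conj 1.3, verified n ≤ 9) may fail in higher weight.
sources: BrownCarrSchneps2010, Brown2012, ZagierECM1994, IharaKanekoZagier2006, Literature.NumberTheory.Transcendental.KZ.mzvRep_value_holds
[crux] SCISSORS COMPLETENESS ON THE HOMOGENEOUS MZV SECTOR (the sector node of the thesis): for
every weight w and every c in the subgroup of FormalRep generated by the Kontsevich simplex reps of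
(mzvRep s, weight s = w), KZ.eval c = 0 → c ∈ C12 := AddSubgroup.closure (domainAddRel ∪
integrandAddRel ∪ changeOfVariablesRel) (the Newton–Leibniz-free 'scissors' sub-calculus: rules 1a,
1b, 2). Every true homogeneous Z-linear relation among MZVs is a chain of cuts and Q-semialgebraic
changes of variables inside R^w. Believed via: DestabilisedScissors ∧ (the NL-allowed sector:
CoactionDevissage SectorAssembly ⇐ HoffmanSpan + Zagier/Brown-type independence) — glue
MzvSectorGlue (support, proved privately by the planner); or directly via CellTransfer (all
Brown–Carr–Schneps relations are C12 moves, not yet typed: needs KZ.cellRep) ∧ BCS Conj 1.3/1.4 ∧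
ZagierConjecture. Weights ≤ 3 are provable now (w ≤ 2: kernel trivial; w = 3: ζ(3) = ζ(2,1) is ONE
rule-2 instance, the duality map t ↦ (1 − t_{w−1−i}) of MultipleZetaDuality, cf. CoactionDevissage
Duality 3171); weight 4 = MzvScissorsSectorWeightLeFour. Conjecture-strength as a whole (its truth
for all w contains Zagier-type transcendence in -/
@[route_item "route-KontsevichZagierPeriods-ScissorsAvatars", crux]
def MzvScissorsSector : Prop :=
  ∀ (w : ℕ) (c : Literature.NumberTheory.Transcendental.KZ.FormalRep), c ∈ AddSubgroup.closure {x : Literature.NumberTheory.Transcendental.KZ.FormalRep | ∃ (s : List ℕ) (hs : Literature.NumberTheory.Transcendental.MZV.IsAdmissible s), Literature.NumberTheory.Transcendental.MZV.weight s = w ∧ x = Literature.NumberTheory.Transcendental.KZ.of (Literature.NumberTheory.Transcendental.KZ.mzvRep s hs (Literature.NumberTheory.Transcendental.KZ.mzvIntegrand_isSemialgebraicFunOn_holds s) (Literature.NumberTheory.Transcendental.KZ.mzvIntegrand_integrableOn_holds s hs))} → Literature.NumberTheory.Transcendental.KZ.eval c = 0 → c ∈ AddSubgroup.closure (Literature.NumberTheory.Transcendental.KZ.domainAddRel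 ∪ Literature.NumberTheory.Transcendental.KZ.integrandAddRel ∪ Literature.NumberTheory.Transcendental.KZ.changeOfVariablesRel)

/-- item stmt-KontsevichZagierPeriods-4265 · crux (kind.auto-crux: conjecture-grade) · rank 9 · open · by planner
why it might fail: auto-crux — summit-strength (notes:refuter-refute-pool-g42-11): the deciding theorem assumes it and nothing in the route derives it, so it is a bet, not glue
sources: closes-admissibility
[support][complement — NOT staffed, not a kill switch] Every vanishing formal combination is
KZ-equivalent to a vanishing HOMOGENEOUS combination of Kontsevich simplex reps: ∀ c, eval c = 0 → ∃
w c′, c′ ∈ span{of (mzvRep s) : weight s = w} ∧ eval c′ = 0 ∧ c − c′ ∈ KZ.relations. This is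
Conjecture 1 off the MZV sector together with weight separation (implied by the summit with c′ = 0;
owned by routes Grothendieck / CoactionDevissage / LowDimension / ExpConservative). It is filed only
so that the Assembly is an honest, provable implication in which the sector crux is load-bearing.
[difficulty: open-problem] -/
@[route_item "route-KontsevichZagierPeriods-ScissorsAvatars", crux]
def OffSectorReduction : Prop :=
  ∀ (c : Literature.NumberTheory.Transcendental.KZ.FormalRep), Literature.NumberTheory.Transcendental.KZ.eval c = 0 → ∃ (w : ℕ) (c' : Literature.NumberTheory.Transcendental.KZ.FormalRep), c' ∈ AddSubgroup.closure {x : Literature.NumberTheory.Transcendental.KZ.FormalRep | ∃ (s : List ℕ) (hs : Literature.NumberTheory.Transcendental.MZV.IsAdmissible s), Literature.NumberTheory.Transcendental.MZV.weight s = w ∧ x = Literature.NumberTheory.Transcendental.KZ.of (Literature.NumberTheory.Transcendental.KZ.mzvRep s hs (Literature.NumberTheory.Transcendental.KZ.mzvIntegrand_isSemialgebraicFunOn_holds s) (Literature.NumberTheory.Transcendental.KZ.mzvIntegrand_integrableOn_holds s hs))} ∧ Literature.NumberTheory.Transcendental.KZ.eval c' = 0 ∧ c - c' ∈ Literature.N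umberTheory.Transcendental.KZ.relations

/-- item stmt-KontsevichZagierPeriods-4260 · support · rank 9 · open · by planner
[support] 3ζ(4) = 4ζ(2,2) inside C12: same domain as Zeta31Scissors, integrands 3/(t0 t1 t2 (1−t3))
[3 × word 0001] and 4/(t0 (1−t1) t2 (1−t3)) [4 × word 0101]; both values π⁴/30 (tree:
multipleZeta_four, multipleZeta_two_two). Equivalent, given the shuffle decomposition of the
ζ(2)·ζ(2) product rep (six order cells, rules 1a+2) and Zeta31Scissors, to '2ζ(2)² = 5ζ(4) in C12'.
Second child of the weight-4 sector statement. [deps: Zeta31Scissors, DivisibilityScissors]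
[difficulty: L] -/
@[route_item "route-KontsevichZagierPeriods-ScissorsAvatars"]
def Zeta22Scissors : Prop :=
  ∀ (r r' : Literature.NumberTheory.Transcendental.KZ.IntegralRep 4), r.domain = {t | 1 > t 0 ∧ t 0 > t 1 ∧ t 1 > t 2 ∧ t 2 > t 3 ∧ t 3 > 0} → Set.EqOn r.integrand (fun t => 3 / (t 0 * t 1 * t 2 * (1 - t 3))) r.domain → r'.domain = r.domain → Set.EqOn r'.integrand (fun t => 4 / (t 0 * (1 - t 1) * t 2 * (1 - t 3))) r'.domain → Literature.NumberTheory.Transcendental.KZ.of r - Literature.NumberTheory.Transcendental.KZ.of r' ∈ AddSubgroup.closure (Literature.NumberTheory.Transcendental.KZ.domainAddRel ∪ Literature.NumberTheory.Transcendental.KZ.integrandAddRel ∪ Literature.NumberTheory.Transcendental.KZ.changeOfVariablesRel)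

/-- item stmt-KontsevichZagierPeriods-4261 · support · rank 9 · open · by planner
[support][cheapest falsifier of the thesis] Euler's ζ(2) = π²/6 as a scissors identity IN THE PLANE:
[{1>t0>t1>0}, 6/(t0(1−t1))] (= 6ζ(2)) minus [R², 1/((1+x²)(1+y²))] (= π²) lies in C12. Chain (all
rules 1a/1b/2, after KontsevichZagier2001 §1.2 pp.9–10): (s,t) = (xy, x) turns the simplex rep into
[(0,1)², 1/(1−xy)] (Jacobian x); 1/(1−xy) = 1/(1−x²y²) + xy/(1−x²y²) (1b, both positive); (u,v) =
(x²,y²) turns [xy/(1−x²y²)] into [(0,1)², 1/(4(1−uv))]; scaling bookkeeping by 1b; KZ's algebraic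
substitution x = ξ²(1+η²)/(1+ξ²), y = η²(1+ξ²)/(1+η²) (their p.9, with √(xy) compiled: apply it to
the even part 1/(1−x²y²) via x = X², y = Y² first) lands on [ {ξ,η>0, ξη<1}, c/((1+ξ²)(1+η²)) ]; the
involution (ξ,η) ↦ (1/ξ,1/η) (rule 2, preserves the form) identifies {ξη<1} with {ξη>1}; sign
symmetries (rule 2) assemble R². No series step: the identification I = 3ζ(2) that KZ do by
expanding a geometric series is replaced by the even/odd splitting above. Cousins with NL allowed:
CompiledSubstitutions ZetaEvenBKC (k = 1, cube target) and CoactionDevissage EulerBasel (target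
piRep·piRep, dimension 4). If this cannot be closed inside C12 the thesis is dead on arrival.
[difficulty: M] -/
@[route_item "route-KontsevichZagierPeriods-ScissorsAvatars"]
def EulerScissors : Prop :=
  ∀ (r q : Literature.NumberTheory.Transcendental.KZ.IntegralRep 2), r.domain = Literature.NumberTheory.Transcendental.KZ.openOrderedSimplex 2 → Set.EqOn r.integrand (fun t => 6 / (t 0 * (1 - t 1))) r.domain → q.domain = Set.univ → Set.EqOn q.integrand (fun t => 1 / ((1 + t 0 ^ 2) * (1 + t 1 ^ 2))) q.domain → Literature.NumberTheory.Transcendental.KZ.of r - Literature.NumberTheory.Transcendental.KZ.of q ∈ AddSubgroup.closure (Literature.NumberTheory.Transcendental.KZ.domainAddRel ∪ Literature.NumberTheory.Transcendental.KZ.integrandAddRel ∪ Literature.NumberTheory.Transcendental.KZ.changeOfVariablesRel)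

/-- item stmt-KontsevichZagierPeriods-4262 · support · rank 9 · closed · proved by Summit.KontsevichZagierPeriods.ScissorsAvatars.divisibilityScissors_proof @ 34e6b5f5b118 (prover) · by planner
[support] The scissors quotient is torsion-free: N•c ∈ C12 → c ∈ C12 (N ≥ 1). Proof sketch (no slabs
available in fixed dimension, unlike CoactionDevissage TorsionFree 3169): the additive endomorphism
S_N [σ,f] := [σ, f/N] of FormalRep maps each of domainAddRel, integrandAddRel, changeOfVariablesRel
into itself (all three are homogeneous under scaling the integrands), hence S_N(C12) ⊆ C12; and x −
N•S_N x ∈ closure(integrandAddRel) for every x ([σ,f] = [σ,f/N] + [σ,(N−1)f/N], induct). So N•c ∈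
C12 ⇒ S_N(N•c) = N•S_N c ∈ C12 ⇒ c ∈ N•S_N c + C12 ⊆ C12. (IntegralRep with integrand f/N: same
domain, semialgebraic and integrable.) Card integral-domain-roots-of-identities L0 states the
analogue for KZ.relations. Needed to clear denominators of Q-derivations (BCS relations have
rational coefficients). [difficulty: provable-now] -/
@[route_item "route-KontsevichZagierPeriods-ScissorsAvatars"]
def DivisibilityScissors : Prop :=
  ∀ (c : Literature.NumberTheory.Transcendental.KZ.FormalRep) (N : ℕ), 0 < N → N • c ∈ AddSubgroup.closure (Literature.NumberTheory.Transcendental.KZ.domainAddRel ∪ Literature.NumberTheory.Transcendental.KZ.integrandAddRel ∪ Literature.NumberTheory.Transcendental.KZ.changeOfVariablesRel) → c ∈ AddSubgroup.closure (Literature.NumberTheory.Transcendental.KZ.domainAddRel ∪ Literature.NumberTheory.Transcendental.KZ.integrandAddRel ∪ Literature.NumberTheory.Transcendental.KZ.changeOfVariablesRel)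

/-- item stmt-KontsevichZagierPeriods-4263 · support · rank 9 · open · by planner
[support] The sector statement in weights ≤ 4, unconditional modulo the two weight-4 scissors
relations: ∀ w ≤ 4, c ∈ span{of (mzvRep s) : weight s = w}, eval c = 0 → c ∈ C12. Weights 0–2: the
span is Z·[one rep] with non-zero value (w = 0: the constant 1; w = 2: ζ(2) > 0), so eval c = 0
forces c = 0. Weight 3: admissible indices (3), (2,1); [ζ(3)-rep] − [ζ(2,1)-rep] ∈
changeOfVariablesRel by the duality involution (|det| = 1, maps the simplex to itself, swaps ω0 ↔ ω1
and reverses the word: MultipleZetaDuality.dualMap), and ζ(3) > 0 pins the kernel to Z·that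
difference (values via KZ.mzvRep_value_holds + multipleZeta_duality or directly from soundness of
the move). Weight 4: indices (4), (3,1), (2,2), (2,1,1); kernel of eval = {4a + b + 3c + 4d = 0} by
mzvSpace_four_eq / multipleZeta_four, _three_one, _two_two and duality ζ(2,1,1) = ζ(4); generated
over Q by the duality move (2,1,1)↔(4), Zeta31Scissors and Zeta22Scissors (after 1b bookkeeping
n•[Δ,f] ~ [Δ,n f]); integrality via DivisibilityScissors. [deps: Zeta31Scissors, Zeta22Scissors,
DivisibilityScissors] [difficulty: M after deps] -/
@[route_item "route-KontsevichZagierPeriods-ScissorsAvatars"]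
def MzvScissorsSectorWeightLeFour : Prop :=
  ∀ (w : ℕ), w ≤ 4 → ∀ (c : Literature.NumberTheory.Transcendental.KZ.FormalRep), c ∈ AddSubgroup.closure {x : Literature.NumberTheory.Transcendental.KZ.FormalRep | ∃ (s : List ℕ) (hs : Literature.NumberTheory.Transcendental.MZV.IsAdmissible s), Literature.NumberTheory.Transcendental.MZV.weight s = w ∧ x = Literature.NumberTheory.Transcendental.KZ.of (Literature.NumberTheory.Transcendental.KZ.mzvRep s hs (Literature.NumberTheory.Transcendental.KZ.mzvIntegrand_isSemialgebraicFunOn_holds s) (Literature.NumberTheory.Transcendental.KZ.mzvIntegrand_integrableOn_holds s hs))} → Literature.NumberTheory.Transcendental.KZ.eval c = 0 → c ∈ AddSubgroup.closure (Literature.NumberTheory.Transcendental.KZ.domainAddRel ∪ Literature.NumberTheory.Transcendental.KZ.integrandAddRel ∪ Literature.NumberTheory.Transcendental.KZ.changeOfVariablesRel)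

/-- item stmt-KontsevichZagierPeriods-4264 · support · rank 9 · open · by planner
[support][glue, proved privately in the planner's Sketch.lean, 6 lines] DestabilisedScissors →
(NL-allowed homogeneous MZV sector: ∀ w c, c ∈ span{of (mzvRep s) : weight s = w} → eval c = 0 → c ∈
KZ.relations) → MzvScissorsSector. Proof: the span of weight-w simplex reps sits inside
closure(range (of : IntegralRep w → FormalRep)) (subst weight s = w), apply DestabilisedScissors w.
The middle hypothesis is CoactionDevissage's SectorAssembly conclusion restricted to one weight.
[difficulty: provable-now] -/
@[route_item "route-KontsevichZagierPeriods-ScissorsAvatars"]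
def MzvSectorGlue : Prop :=
  DestabilisedScissors → (∀ (w : ℕ) (c : Literature.NumberTheory.Transcendental.KZ.FormalRep), c ∈ AddSubgroup.closure {x : Literature.NumberTheory.Transcendental.KZ.FormalRep | ∃ (s : List ℕ) (hs : Literature.NumberTheory.Transcendental.MZV.IsAdmissible s), Literature.NumberTheory.Transcendental.MZV.weight s = w ∧ x = Literature.NumberTheory.Transcendental.KZ.of (Literature.NumberTheory.Transcendental.KZ.mzvRep s hs (Literature.NumberTheory.Transcendental.KZ.mzvIntegrand_isSemialgebraicFunOn_holds s) (Literature.NumberTheory.Transcendental.KZ.mzvIntegrand_integrableOn_holds s hs))} → Literature.NumberTheory.Transcendental.KZ.eval c = 0 → c ∈ Literature.NumberTheory.Transcendental.KZ.relations) → MzvScissorsSector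

/-- item stmt-KontsevichZagierPeriods-4266 · assembly · rank 1 · closed · proved by Summit.KontsevichZagierPeriods.ScissorsAvatars.assembly_proof @ 71d4d39983ab (prover) · by planner
[assembly] FiveTermScissors → DestabilisedScissors → Zeta31Scissors → MzvScissorsSector →
OffSectorReduction → KontsevichZagierPeriods. PROVED privately in the planner's Sketch.lean (12
lines): given r, r′ rational with equal values, eval (of r − of r′) = 0 (map_sub, eval_of);
OffSectorReduction gives w, c′ in the weight-w MZV span with eval c′ = 0 and of r − of r′ − c′ ∈
relations; MzvScissorsSector gives c′ ∈ C12 ⊆ relations (AddSubgroup.closure_mono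
Set.subset_union_left after unfolding KZ.relations); add. The first three hypotheses are the route's
concrete/structural cruxes and are not used formally — the sector node MzvScissorsSector is the
load-bearing one (it follows from DestabilisedScissors + the NL-allowed sector by MzvSectorGlue).
[difficulty: provable-now] -/
@[route_item "route-KontsevichZagierPeriods-ScissorsAvatars"]
def Assembly : Prop :=
  FiveTermScissors → DestabilisedScissors → Zeta31Scissors → MzvScissorsSector → OffSectorReduction → KontsevichZagierPeriods

/-! D-0027 §2.1 — DECIDING THEOREM (planner-authored via `route open/edit --closes-file`; by planner-rbadge-KontsevichZagierPeriods-Scissor-b4f38ceb-g2-0 2026-08-15T16:12:59Z):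
its hypotheses are this route's items and its conclusion the sub-problem Statement (glue_lint), and it elaborates with this file. -/

@[closes "route-KontsevichZagierPeriods-ScissorsAvatars"] theorem closes (hS : MzvScissorsSector) (hO : OffSectorReduction) : KontsevichZagierPeriods := by
  intro n m r r' _ _ hv
  have h0 : Literature.NumberTheory.Transcendental.KZ.eval
      (Literature.NumberTheory.Transcendental.KZ.of r - Literature.NumberTheory.Transcendental.KZ.of r') = 0 := by
    simp [Literature.NumberTheory.Transcendental.KZ.eval_of, hv]
  obtain ⟨w, c', hc', hc'0, hrel⟩ := hO _ h0
  have hc'rel : c' ∈ Literature.NumberTheory.Transcendental.KZ.relations :=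
    AddSubgroup.closure_mono Set.subset_union_left (hS w c' hc' hc'0)
  have hsum : Literature.NumberTheory.Transcendental.KZ.of r - Literature.NumberTheory.Transcendental.KZ.of r'
      = (Literature.NumberTheory.Transcendental.KZ.of r - Literature.NumberTheory.Transcendental.KZ.of r' - c') + c' := by
    abel
  show Literature.NumberTheory.Transcendental.KZ.of r - Literature.NumberTheory.Transcendental.KZ.of r'
      ∈ Literature.NumberTheory.Transcendental.KZ.relations
  rw [hsum]
  exact Literature.NumberTheory.Transcendental.KZ.relations.add_mem hrel hc'rel

end Summit.KontsevichZagierPeriods.KontsevichZagierPeriods.Theses.ScissorsAvatars
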